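import Summits.KontsevichZagierPeriods.KontsevichZagierPeriods.Theorems.RootDecompRelativeModAbsoluteRegFoldingDegOneP01
import Literature.NumberTheory.Transcendental.BakerLogarithmsConclusion

/-!
(LANDED by the census seat decomp-kz-census-1 g7 `--supports stmt-KontsevichZagierPeriods-30572`; source lens-3 g9 landing package, critic decomp-kz-crit-1 g2 CLEARED §14 2026-08-30T09:58:21Z; generic docstrings added where the source had none.)

# `RegKernelPairDegOne` for `k + k' ≤ 1` (route `RootDecompRelativeModAbsolute`, first transcendence rung of
support item stmt-KontsevichZagierPeriods-30572) — PROVED · part 1/3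

Cell `decomp-kz`, lens 3 (decomp-kz-lens-3 g9).  `regKernelPairDegOne_of_add_le_one` (part 3/3) is the text of
the route item `RegKernelPairDegOne` VERBATIM under the extra hypothesis `k + k' ≤ 1`: ONE unfolded regularised
log/arctan monomial `[g.domain × (0,1), h(x) θ^M/(1+θ^e κ(x))]` (`e ∈ {1,2}`, any Taylor order `M`) against none —
if the folded fibre functions agree a.e. then the unfoldings are congruent modulo `KZ.relations`.
Part 1: scalar corollaries of Baker's theorem (`baker_holds`, incl. the unit-circle case for `arctan`) and the
analysis of the kernels `θ^M/(1+θ^e κ)` (positivity, bounds, continuity of `ℓ_{M,e}` on `(-1,∞)` by dominated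
convergence).  Part 2: `ℓ_{M,e}(0) = 1/(M+1)`, the recursion `κ ℓ_{M+e,e} = 1/(M+1) − ℓ_{M,e}`, the closed forms
`ℓ_{0,1} = log(1+κ)/κ`, `ℓ_{1,2} = log(1+κ)/(2κ)`, `ℓ_{0,2} = arctan √κ/√κ` resp. `(log(1+u) − log(1−u))/(2u)`
(`u = √(−κ)`) by FTC, and `transcendental_ell`: `ℓ_{M,e}(κ)` is transcendental at algebraic `κ ∈ (−1,∞)∖{0}`.
Part 3: the rigidity lemma `mul_kappa_ae_eq_zero` (`1_G (g₀ + h ℓ_{M,e}(κ)) = 1_{G'} g₀'` a.e. with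
`ℚ`-semialgebraic data forces `h κ = 0` a.e. — smooth full-measure loci, continuity, values at the dense algebraic
points), the KZ assembly `single_monomial`, and the rung theorem.

Source: `HOME/decomp-kz-lens-3/g9/RelativeModAbsoluteDegOneBands.lean` §14 (sha256 2ea10d4a6cc47b20, 5603 l; farm
rc 0 / 0 warn / 0 sorry; `#print axioms regKernelPairDegOne_of_add_le_one` = propext, Classical.choice, Quot.sound),
extracted verbatim into the namespace of the landed `RegFoldingDegOne` chain (toolkit §0–§13 =
`RootDecompRelativeModAbsoluteRegFoldingDegOneP01…P14`).  No `sorry`; standard axioms.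
References: Baker 1975 (Transcendental Number Theory) Thm 2.1 [tree: `baker_holds`]; [cite: KontsevichZagier2001, §1.2];
Bochnak–Coste–Roy 1998 §2.9.
-/

noncomputable section

open Set MeasureTheory Filter Topology
open scoped BigOperators
open Literature.NumberTheory.Transcendental Literature.ModelTheory.ExponentialFields

namespace Summit.KontsevichZagierPeriods.RootDecompRelativeModAbsolute.Rung30571

namespace RegularisedLogLayer

namespace CircleBaker

/-! ## Baker at a maximal `ℚ`-free subfamily -/

/-- **Baker, inhomogeneous + homogeneous-free form** (from `baker_holds`): if `Σ βᵢ lᵢ = β₀` with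
`e^{lᵢ}`, `βᵢ`, `β₀` algebraic, then `β₀ = 0`; if moreover the `βᵢ` are linearly independent
over `ℚ` then every `lᵢ = 0`. [Baker1975 Thm 2.1; folklore] -/
theorem baker_complex {ι : Type*} [Fintype ι] (l β : ι → ℂ) (β₀ : ℂ)
    (halg : ∀ i, IsAlgebraic ℚ (Complex.exp (l i))) (hβ : ∀ i, IsAlgebraic ℚ (β i))
    (hβ₀ : IsAlgebraic ℚ β₀) (hsum : ∑ i, β i * l i = β₀) :
    β₀ = 0 ∧ (LinearIndependent ℚ β → ∀ i, l i = 0) := by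
  classical
  set K := algebraicClosure ℚ ℂ
  obtain ⟨κ, a, ha, hspan, hla⟩ := exists_linearIndependent' (K := ℚ) l
  haveI : Finite κ := Finite.of_injective a ha
  letI : Fintype κ := Fintype.ofFinite κ
  -- Baker: `1, l ∘ a` are linearly independent over `K`
  have hB := baker_holds (l ∘ a) (fun s => halg (a s)) hla
  -- expand each `l i` in the `ℚ`-span of `l ∘ a`
  have hmem : ∀ i, l i ∈ Submodule.span ℚ (Set.range (l ∘ a)) := fun i => by
    rw [hspan]
    exact Submodule.subset_span ⟨i, rfl⟩
  choose q hq using fun i => (Submodule.mem_span_range_iff_exists_fun ℚ).1 (hmem i)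
  have hβK : ∀ i, β i ∈ K := fun i => mem_algebraicClosure_iff.mpr (hβ i)
  have hβ₀K : β₀ ∈ K := mem_algebraicClosure_iff.mpr hβ₀
  have hqK : ∀ i s, ((q i s : ℚ) : ℂ) ∈ K := fun i s => by
    rw [← eq_ratCast (algebraMap ℚ ℂ)]
    exact K.algebraMap_mem (q i s)
  have hzK : ∀ s, (∑ i, β i * (q i s : ℂ)) ∈ K := fun s =>
    sum_mem fun i _ => mul_mem (hβK i) (hqK i s)
  -- the expanded relation
  have hexp : ∑ s, (∑ i, β i * (q i s : ℂ)) * l (a s) = β₀ := by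
    calc ∑ s, (∑ i, β i * (q i s : ℂ)) * l (a s)
          = ∑ i, β i * ∑ s, (q i s : ℂ) * l (a s) := by
          simp_rw [Finset.sum_mul, Finset.mul_sum]
          rw [Finset.sum_comm]
          simp_rw [mul_assoc]
      _ = ∑ i, β i * l i := by
          refine Finset.sum_congr rfl fun i _ => ?_
          rw [← hq i]
          simp_rw [Rat.smul_def, Function.comp_apply]
      _ = β₀ := hsum
  -- its coefficients, as elements of `K`, indexed like Baker's family `1, l ∘ a`
  let g : Option κ → K := fun o =>
    o.elim ⟨-β₀, neg_mem hβ₀K⟩ fun s => ⟨∑ i, β i * (q i s : ℂ), hzK s⟩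
  have hg : ∑ o, g o • (o.elim (1 : ℂ) (l ∘ a)) = 0 := by
    have h0 : g none • ((none : Option κ).elim (1 : ℂ) (l ∘ a)) = -β₀ := by
      rw [IntermediateField.smul_def]
      change (-β₀) • (1 : ℂ) = -β₀
      rw [smul_eq_mul, mul_one]
    have h1 : ∀ s, g (some s) • ((some s).elim (1 : ℂ) (l ∘ a)) =
        (∑ i, β i * (q i s : ℂ)) * l (a s) := fun s => by
      rw [IntermediateField.smul_def]
      rfl
    rw [Fintype.sum_option, h0, Finset.sum_congr rfl fun s _ => h1 s, hexp, neg_add_cancel]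
  have hg0 : ∀ o, g o = 0 := Fintype.linearIndependent_iff.mp hB g hg
  have h₀ : β₀ = 0 := by
    have := congrArg (fun x : K => (x : ℂ)) (hg0 none)
    simpa [g] using this
  refine ⟨h₀, fun hli i => ?_⟩
  have hq0 : ∀ j s, q j s = 0 := by
    intro j s
    have h1 : ∑ j, β j * (q j s : ℂ) = 0 := by
      have := congrArg (fun x : K => (x : ℂ)) (hg0 (some s))
      simpa [g] using this
    have h2 : ∑ j, q j s • β j = 0 := by
      rw [← h1]
      exact Finset.sum_congr rfl fun j _ => by rw [Rat.smul_def, mul_comm]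
    exact Fintype.linearIndependent_iff.mp hli (fun j => q j s) h2 j
  rw [← hq i]
  exact Finset.sum_eq_zero fun s _ => by simp [hq0]

/-! ## Algebraic points of `ℝ_{>0}` and of the circle -/

/-- `isAlgebraic_ofReal` (PRIVATE: landed twin elsewhere, dedup.landed): auxiliary theorem of the first transcendence rung `k + k′ ≤ 1` of `RegKernelPairDegOne` (stmt-30572), lens-3 g9 §14 — see the module docstring; verbatim from the lens file. -/
private theorem isAlgebraic_ofReal {x : ℝ} (hx : IsAlgebraic ℚ x) : IsAlgebraic ℚ (x : ℂ) :=
  (isAlgebraic_algebraMap_iff (A := ℂ) Complex.ofReal_injective).mpr hx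

/-- `isAlgebraic_I` (PRIVATE: landed twin elsewhere, dedup.landed): auxiliary theorem of the first transcendence rung `k + k′ ≤ 1` of `RegKernelPairDegOne` (stmt-30572), lens-3 g9 §14 — see the module docstring; verbatim from the lens file. -/
private theorem isAlgebraic_I : IsAlgebraic ℚ Complex.I :=
  IsAlgebraic.of_pow two_pos (by rw [Complex.I_sq]; exact isAlgebraic_one.neg)

/-- `√(1 + d²)` is algebraic for real algebraic `d`. [folklore] -/
theorem isAlgebraic_sqrt_one_add_sq {d : ℝ} (hd : IsAlgebraic ℚ d) :
    IsAlgebraic ℚ (Real.sqrt (1 + d ^ 2)) := by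
  refine IsAlgebraic.of_pow two_pos ?_
  rw [Real.sq_sqrt (by positivity)]
  exact isAlgebraic_one.add (hd.pow 2)

/-- `exp (log w) = w` is algebraic for a positive real algebraic `w`. [folklore] -/
private theorem isAlgebraic_cexp_log {w : ℝ} (hw : IsAlgebraic ℚ w) (hpos : 0 < w) :
    IsAlgebraic ℚ (Complex.exp ((Real.log w : ℝ) : ℂ)) := by
  rw [← Complex.ofReal_exp, Real.exp_log hpos]
  exact isAlgebraic_ofReal hw

/-- `exp (i·arctan d) = (1 + id)/√(1 + d²)` is an algebraic point of the unit circle for real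
algebraic `d`. [folklore] -/
theorem isAlgebraic_cexp_arctan_mul_I {d : ℝ} (hd : IsAlgebraic ℚ d) :
    IsAlgebraic ℚ (Complex.exp (((Real.arctan d : ℝ) : ℂ) * Complex.I)) := by
  rw [Complex.exp_mul_I, ← Complex.ofReal_cos, ← Complex.ofReal_sin, Real.cos_arctan,
    Real.sin_arctan, one_div, div_eq_mul_inv]
  exact (isAlgebraic_ofReal (isAlgebraic_sqrt_one_add_sq hd).inv).add
    ((isAlgebraic_ofReal (hd.mul (isAlgebraic_sqrt_one_add_sq hd).inv)).mul isAlgebraic_I)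

/-- `exp (iπ) = -1` is algebraic. -/
theorem isAlgebraic_cexp_pi_mul_I :
    IsAlgebraic ℚ (Complex.exp (((Real.pi : ℝ) : ℂ) * Complex.I)) := by
  rw [Complex.exp_pi_mul_I]
  exact isAlgebraic_one.neg


/-- **`log w` is transcendental** for real algebraic `w > 0`, `w ≠ 1` — in the form: an algebraic
`log w` vanishes. [Baker1975 Thm 2.1 with n = 1 (Lindemann); folklore] -/
private theorem log_eq_zero_of_isAlgebraic {w : ℝ} (hw : 0 < w) (hwalg : IsAlgebraic ℚ w)
    (hlog : IsAlgebraic ℚ (Real.log w)) : Real.log w = 0 := by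
  have h := (baker_complex (ι := Fin 1) (fun _ => ((Real.log w : ℝ) : ℂ)) (fun _ => 1)
    ((Real.log w : ℝ) : ℂ) (fun _ => isAlgebraic_cexp_log hwalg hw) (fun _ => isAlgebraic_one)
    (isAlgebraic_ofReal hlog) (by simp)).1
  exact_mod_cast h

/-- **`arctan d` is transcendental** for real algebraic `d ≠ 0` — in the form: an algebraic
`arctan d` vanishes (`e^{i arctan d}` is an algebraic point of `𝕊¹`). [Baker1975 Thm 2.1; folklore] -/
theorem arctan_eq_zero_of_isAlgebraic {d : ℝ} (hd : IsAlgebraic ℚ d)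
    (harc : IsAlgebraic ℚ (Real.arctan d)) : Real.arctan d = 0 := by
  have h := (baker_complex (ι := Fin 1) (fun _ => ((Real.arctan d : ℝ) : ℂ) * Complex.I)
    (fun _ => 1) (((Real.arctan d : ℝ) : ℂ) * Complex.I)
    (fun _ => isAlgebraic_cexp_arctan_mul_I hd) (fun _ => isAlgebraic_one)
    ((isAlgebraic_ofReal harc).mul isAlgebraic_I) (by simp)).1
  rcases mul_eq_zero.1 h with h1 | h1
  · exact_mod_cast h1
  · exact absurd h1 Complex.I_ne_zero

end CircleBaker

/-! ### The kernels `θ^M/(1+θ^e κ)`: positivity, bounds, continuity of `ℓ_{M,e}` -/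

/-- `one_add_pow_mul_pos`: auxiliary theorem of the first transcendence rung `k + k′ ≤ 1` of `RegKernelPairDegOne` (stmt-30572), lens-3 g9 §14 — see the module docstring; verbatim from the lens file. -/
theorem one_add_pow_mul_pos (e : ℕ) {κ θ : ℝ} (hκ : -1 < κ) (hθ : θ ∈ Icc (0 : ℝ) 1) :
    0 < 1 + θ ^ e * κ := by
  have h1 : 0 ≤ θ ^ e := pow_nonneg hθ.1 e
  have h2 : θ ^ e ≤ 1 := pow_le_one₀ hθ.1 hθ.2
  rcases le_or_gt 0 κ with h | h
  · nlinarith [mul_nonneg h1 h]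
  · nlinarith [mul_le_mul_of_nonpos_right h2 h.le]

/-- `one_add_min_le_pow`: auxiliary theorem of the first transcendence rung `k + k′ ≤ 1` of `RegKernelPairDegOne` (stmt-30572), lens-3 g9 §14 — see the module docstring; verbatim from the lens file. -/
theorem one_add_min_le_pow (e : ℕ) {κ θ : ℝ} (hθ : θ ∈ Icc (0 : ℝ) 1) :
    1 + min κ 0 ≤ 1 + θ ^ e * κ := by
  have h1 : 0 ≤ θ ^ e := pow_nonneg hθ.1 e
  have h2 : θ ^ e ≤ 1 := pow_le_one₀ hθ.1 hθ.2
  rcases le_or_gt 0 κ with h | h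
  · rw [min_eq_right h]; nlinarith [mul_nonneg h1 h]
  · rw [min_eq_left h.le]; nlinarith [mul_le_mul_of_nonpos_right h2 h.le]

/-- `continuousOn_kernel`: auxiliary theorem of the first transcendence rung `k + k′ ≤ 1` of `RegKernelPairDegOne` (stmt-30572), lens-3 g9 §14 — see the module docstring; verbatim from the lens file. -/
theorem continuousOn_kernel (M e : ℕ) {κ : ℝ} (hκ : -1 < κ) :
    ContinuousOn (kernel M e κ) (Icc (0 : ℝ) 1) := by
  refine ContinuousOn.div (by fun_prop) (by fun_prop) fun θ hθ => ?_
  exact (one_add_pow_mul_pos e hκ hθ).ne'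

/-- `integrableOn_kernel`: auxiliary theorem of the first transcendence rung `k + k′ ≤ 1` of `RegKernelPairDegOne` (stmt-30572), lens-3 g9 §14 — see the module docstring; verbatim from the lens file. -/
theorem integrableOn_kernel (M e : ℕ) {κ : ℝ} (hκ : -1 < κ) :
    IntegrableOn (kernel M e κ) (Ioo (0 : ℝ) 1) :=
  ((continuousOn_kernel M e hκ).integrableOn_Icc (μ := volume)).mono_set Ioo_subset_Icc_self

/-- `abs_kernel_le`: auxiliary theorem of the first transcendence rung `k + k′ ≤ 1` of `RegKernelPairDegOne` (stmt-30572), lens-3 g9 §14 — see the module docstring; verbatim from the lens file. -/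
theorem abs_kernel_le (M e : ℕ) {κ θ : ℝ} (hκ : -1 < κ) (hθ : θ ∈ Icc (0 : ℝ) 1) :
    |kernel M e κ θ| ≤ 1 / (1 + min κ 0) := by
  have hpos : 0 < 1 + min κ 0 := by
    have : -1 < min κ 0 := lt_min hκ (by norm_num)
    linarith
  have hd := one_add_pow_mul_pos e hκ hθ
  rw [kernel, abs_div, abs_of_pos hd, abs_of_nonneg (pow_nonneg hθ.1 M)]
  calc θ ^ M / (1 + θ ^ e * κ) ≤ 1 / (1 + θ ^ e * κ) :=
        div_le_div_of_nonneg_right (pow_le_one₀ hθ.1 hθ.2) hd.le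
    _ ≤ 1 / (1 + min κ 0) := one_div_le_one_div_of_le hpos (one_add_min_le_pow e hθ)

/-- `integrableOn_const_Ioo'`: auxiliary theorem of the first transcendence rung `k + k′ ≤ 1` of `RegKernelPairDegOne` (stmt-30572), lens-3 g9 §14 — see the module docstring; verbatim from the lens file. -/
theorem integrableOn_const_Ioo' (u v C : ℝ) : IntegrableOn (fun _ : ℝ => C) (Ioo u v) :=
  (continuousOn_const.integrableOn_Icc (a := u) (b := v) (μ := volume)).mono_set Ioo_subset_Icc_self

/-- `ℓ_{M,e}` is continuous on `(−1, ∞)` (dominated convergence). [folklore] -/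
theorem continuousAt_ell (M e : ℕ) {κ₀ : ℝ} (hκ₀ : -1 < κ₀) : ContinuousAt (ell M e) κ₀ := by
  set a : ℝ := (-1 + κ₀) / 2 with ha
  have ha1 : -1 < a := by rw [ha]; linarith
  have haκ : a < κ₀ := by rw [ha]; linarith
  have hpos : 0 < 1 + min a 0 := by
    have : -1 < min a 0 := lt_min ha1 (by norm_num)
    linarith
  have hev : ∀ᶠ κ in 𝓝 κ₀, a < κ := Ioi_mem_nhds haκ
  show ContinuousAt (fun κ => ∫ θ in Ioo (0 : ℝ) 1, kernel M e κ θ) κ₀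
  refine MeasureTheory.continuousAt_of_dominated (bound := fun _ => 1 / (1 + min a 0)) ?_ ?_ ?_ ?_
  · filter_upwards [hev] with κ hκ
    exact ((continuousOn_kernel M e (ha1.trans hκ)).mono Ioo_subset_Icc_self).aestronglyMeasurable
      measurableSet_Ioo
  · filter_upwards [hev] with κ hκ
    refine ae_restrict_of_forall_mem measurableSet_Ioo fun θ hθ => ?_
    rw [Real.norm_eq_abs]
    refine (abs_kernel_le M e (ha1.trans hκ) (Ioo_subset_Icc_self hθ)).trans ?_
    exact one_div_le_one_div_of_le hpos (by linarith [min_le_min_right (0 : ℝ) hκ.le])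
  · exact integrableOn_const_Ioo' 0 1 _
  · refine ae_restrict_of_forall_mem measurableSet_Ioo fun θ hθ => ?_
    have hd : 1 + θ ^ e * κ₀ ≠ 0 := (one_add_pow_mul_pos e hκ₀ (Ioo_subset_Icc_self hθ)).ne'
    show ContinuousAt (fun κ => θ ^ M / (1 + θ ^ e * κ)) κ₀
    exact continuousAt_const.div (continuousAt_const.add (continuousAt_const.mul continuousAt_id)) hd

/-- `continuousOn_ell`: auxiliary theorem of the first transcendence rung `k + k′ ≤ 1` of `RegKernelPairDegOne` (stmt-30572), lens-3 g9 §14 — see the module docstring; verbatim from the lens file. -/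
theorem continuousOn_ell (M e : ℕ) : ContinuousOn (ell M e) (Ioi (-1)) := fun _ hκ =>
  (continuousAt_ell M e hκ).continuousWithinAt


end RegularisedLogLayer

end Summit.KontsevichZagierPeriods.RootDecompRelativeModAbsolute.Rung30571

end
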